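import Mathlib.NumberTheory.Harmonic.ZetaAsymp
import Mathlib.NumberTheory.Harmonic.EulerMascheroni
import Mathlib.NumberTheory.Harmonic.GammaDeriv
import Mathlib.NumberTheory.LSeries.HurwitzZetaValues
import Mathlib.Analysis.Calculus.Deriv.Star
import Mathlib.Analysis.SpecialFunctions.Log.Basic
import Mathlib.Analysis.SpecialFunctions.Gamma.Digamma
import Mathlib.Analysis.SpecialFunctions.Gamma.BohrMollerup
import Mathlib.Analysis.Complex.ExponentialBounds
import Mathlib.Analysis.Real.Pi.Bounds
import Literature.NumberTheory.LFunctions.ZetaZeros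
import Literature.NumberTheory.LFunctions.RHClassicalEquivalents
import HarnessLib

/-!
# Levinson–Montgomery, Theorem 1, and the reduction of Speiser's theorem to it

Decomposition file (D-0014 named facts) for the discharge of `Literature.NumberTheory.LFunctions.speiser_iff`
(`Literature/NumberTheory/LFunctions/RHClassicalEquivalents.lean`, rh.S18):
`RiemannHypothesis ↔ ∀ s, 0 < re s → re s < 1/2 → ζ'(s) ≠ 0`.

The printed proof (N. Levinson, H. L. Montgomery, *Zeros of the derivatives of the Riemann
zeta-function*, Acta Math. 133 (1974), 49–65, Theorem 1 and its Corollary "essentially due to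
Speiser"; sketched again in Titchmarsh–Heath-Brown §10.28, (10.28.2)–(10.28.6)) goes through the
zero counts of `ζ` and `ζ'` in the open left half `R_T = {0 < σ < 1/2, 0 < t < T}` of the
critical strip:

* **Theorem 1 (1.1).** `N₁⁻(T) = N⁻(T) + O(log T)`;
* **Theorem 1 (1.2).** unless `N⁻(T) > T/2` for all large `T`, there is a sequence `T_j → ∞`
  with `N₁⁻(T_j) = N⁻(T_j)`;

both proved from the partial-fraction formula
`Re ζ'/ζ(s) = −Re 1/(s−1) + ½ log π − ½ Re Γ'/Γ(s/2+1) + Re Σ_ρ 1/(s−ρ)` (LM (2.1)), Stirling's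
formula for `Γ'/Γ` (LM (2.4)), the sign `Re ζ'/ζ < 0` on `σ = 0`, on `t = 10` and on the
critical line indented to the left around the zeros of `ζ(½+it)`, the argument principle, and a
Jensen-type bound for the variation of `arg ζ`, `arg ζ'` on horizontal segments. None of these
ingredients is in Mathlib at the pin, so (1.1) and (1.2) are recorded here as named facts, with
the counting functions `N⁻ = zetaLeftCount`, `N₁⁻ = derivZetaLeftCount` defined for real
(finite sums of multiplicities over finite boxes, with the finiteness proved).

The **assembly step is proved**: `speiser_iff_of_levinsonMontgomery` derives `speiser_iff` from
(1.1), (1.2) and three classical facts about the real axis / the critical strip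
(`Literature.NumberTheory.LFunctions.mem_riemannZetaNontrivialZeros_iff` — non-trivial zeros have `0 < β < 1`;
`riemannZeta_ne_zero_of_mem_Ioo` — `ζ(σ) ≠ 0` for real `0 < σ < 1`, Titchmarsh (2.12.4);
`deriv_riemannZeta_ne_zero_of_mem_Ioo` — `ζ'(σ) ≠ 0` for real `0 < σ < 1/2`), the conjugation
symmetry `ζ'(s̄) = conj ζ'(s)` (proved here from Mathlib's `riemannZeta_conj`) and the
functional equation `riemannZeta_one_sub` (Mathlib). Once the five leaves have `_holds`
theorems, `speiser_iff_holds` is a one-liner.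

**Discharges (section `RealZeros` at the end of the file).** The two real-axis leaves are
proved here: `riemannZeta_ne_zero_of_mem_Ioo_holds` and
`deriv_riemannZeta_ne_zero_of_mem_Ioo_holds`. Both go through Mathlib's Mellin representation
`completedRiemannZeta₀ s = ½ ∫₀^∞ k(t) t^{s/2-1} dt` (`HurwitzZeta.hurwitzEvenFEPair 0`) with the
*non-negative* kernel `k = 𝟙_{t>1}(θ − 1) + 𝟙_{0<t<1}(θ − t^{-1/2})`, `θ(t) = Σ_{n∈ℤ} e^{−πn²t}`:
this gives `Re E(σ) ≤ E(0) + E(1) = 2((γ − log 4π)/2 + 1) < 2/3` on `(0, 1)`, hence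
`Re Λ(σ) = Re E(σ) − 1/σ − 1/(1−σ) < 0` and `ζ(σ) = Λ(σ)/Γℝ(σ) ≠ 0`; and, differentiating under
the integral, `|E'(σ)| ≤ E(1) + E(−1) + E(2) + E(0) < 1`, which together with
`Γℝ'/Γℝ(σ) = −½ log π + ½ ψ(σ/2)`, `ψ(σ/2) = ψ(σ/2 + 1) − 2/σ` and `ψ ≤ ψ(2) = 1 − γ` on `(0, 2]`
(convexity of `log Γ`) contradicts `ζ'(σ) = 0`, i.e. `Λ'(σ) = Λ(σ) Γℝ'/Γℝ(σ)`, for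
`0 < σ < 1/2`. So `speiser_iff_of_levinsonMontgomery_thm1` needs only Theorem 1 and
`Literature.NumberTheory.LFunctions.mem_riemannZetaNontrivialZeros_iff`.

## Contents

* `derivRiemannZetaZeroOrder ρ` : multiplicity of `ρ` as a zero of `ζ'` (pointwise meromorphic
  order, as `Literature.NumberTheory.LFunctions.riemannZetaZeroOrder` does for `ζ`), with `_pos_iff`, `_nonneg`.
* `zetaLeftBox T`, `derivZetaLeftBox T` : zeros of `ζ`, `ζ'` in `R_T` (finite:
  `zetaLeftBox_finite`, `derivZetaLeftBox_finite`).
* `zetaLeftCount T = N⁻(T)`, `derivZetaLeftCount T = N₁⁻(T)` and the detection lemmas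
  `zetaLeftCount_pos`, `derivZetaLeftCount_pos`, `derivZetaLeftBox_nonempty`.
* Named facts `levinsonMontgomery_thm1_isBigO` (1.1), `levinsonMontgomery_thm1_seq` (1.2),
  `riemannZeta_ne_zero_of_mem_Ioo`, `deriv_riemannZeta_ne_zero_of_mem_Ioo`.
* Proved: `deriv_riemannZeta_conj`, `deriv_riemannZeta_zero_ne_zero`,
  `riemannZeta_one_sub_eq_zero`, `speiser_iff_of_levinsonMontgomery`;
  `riemannZeta_ne_zero_of_mem_Ioo_holds`, `deriv_riemannZeta_ne_zero_of_mem_Ioo_holds`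
  (section `RealZeros`: `RealZeros.kernel`, `RealZeros.re_completedRiemannZeta₀_ofReal`,
  `RealZeros.hasDerivAt_completedRiemannZeta₀`, `RealZeros.hasDerivAt_Gammaℝ`,
  `RealZeros.digamma_ofReal`, `RealZeros.completedRiemannZeta₀_two`, …),
  `speiser_iff_of_levinsonMontgomery_thm1`.

## References

* N. Levinson, H. L. Montgomery, *Zeros of the derivatives of the Riemann zeta-function*, Acta
  Math. 133 (1974), 49–65, Theorem 1, (1.1)–(1.2), Corollary p. 49, §2.
* A. Speiser, *Geometrisches zur Riemannschen Zetafunktion*, Math. Ann. 110 (1934), 514–521.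
* E. C. Titchmarsh, *The Theory of the Riemann Zeta-Function*, 2nd ed. (D. R. Heath-Brown),
  OUP 1986, §2.12 (2.12.4) and §10.28.
-/

noncomputable section

open Complex Filter Asymptotics Set
open scoped Real Topology ComplexConjugate

namespace Literature.NumberTheory.LFunctions

/-! ## `ζ'`: analyticity, a non-zero value, conjugation symmetry -/

/-- `ζ'` is analytic on `ℂ ∖ {1}` (derivative of the analytic function `ζ` on the open set
`{1}ᶜ`, `analyticOn_riemannZeta`). [folklore] -/
theorem analyticOnNhd_deriv_riemannZeta : AnalyticOnNhd ℂ (deriv riemannZeta) {1}ᶜ :=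
  analyticOn_riemannZeta.deriv_of_isOpen isOpen_compl_singleton

/-- `ζ'(0) = −½ log 2π ≠ 0` (Mathlib `deriv_riemannZeta_zero`; `2π > 1`). [folklore] -/
theorem deriv_riemannZeta_zero_ne_zero : deriv riemannZeta 0 ≠ 0 := by
  rw [deriv_riemannZeta_zero]
  have hπ : (1 : ℝ) < 2 * π := by linarith [Real.pi_gt_three]
  have hlog : (0 : ℝ) < Real.log (2 * π) := Real.log_pos hπ
  have h : Complex.log (2 * π) = (Real.log (2 * π) : ℂ) := by
    rw [Complex.ofReal_log (by positivity)]
    push_cast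
    rfl
  rw [h]
  intro h0
  have := congrArg Complex.re h0
  simp at this
  rcases this with h | h <;> linarith

/-- Conjugation symmetry of the derivative: `ζ'(s̄) = conj ζ'(s)` for every `s`
(from `riemannZeta_conj` and `deriv_conj_conj`). [folklore] -/
theorem deriv_riemannZeta_conj (s : ℂ) :
    deriv riemannZeta (conj s) = conj (deriv riemannZeta s) := by
  have hf : (conj ∘ riemannZeta ∘ conj) = riemannZeta := by
    funext z
    simp [riemannZeta_conj]
  have h := congr_fun (deriv_conj_conj (f := riemannZeta)) (conj s)
  rw [hf] at h
  simpa using h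

/-- Zeros of `ζ` in the open critical strip are symmetric under `s ↦ 1 − s` (functional
equation `riemannZeta_one_sub`; the `Γ` and cosine factors are finite there). [folklore] -/
theorem LevinsonMontgomery.riemannZeta_one_sub_eq_zero {s : ℂ} (h0 : 0 < s.re) (hs : riemannZeta s = 0) :
    riemannZeta (1 - s) = 0 := by
  have hn : ∀ n : ℕ, s ≠ -n := by
    intro n h
    have := congrArg Complex.re h
    simp at this
    have : (0 : ℝ) ≤ n := n.cast_nonneg
    linarith
  have h1 : s ≠ 1 := by
    intro h; rw [h] at hs; exact riemannZeta_one_ne_zero hs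
  rw [riemannZeta_one_sub hn h1, hs, mul_zero]

/-! ## Multiplicities of zeros of `ζ'` -/

/-- The multiplicity of `ρ` as a zero of `ζ'`: the meromorphic order
`meromorphicOrderAt (deriv riemannZeta) ρ`, sent to `ℤ` by `WithTop.untop₀` (same design as
`Literature.NumberTheory.LFunctions.riemannZetaZeroOrder`, D-ANT-1). Non-negative for `ρ ≠ 1`, positive exactly at the zeros of
`ζ'`; `-2` at the double pole `ρ = 1`. [folklore] -/
def derivRiemannZetaZeroOrder (ρ : ℂ) : ℤ :=
  (meromorphicOrderAt (deriv riemannZeta) ρ).untop₀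

/-- `ζ'` is not identically zero near any `ρ ≠ 1` (identity theorem on the connected set
`{1}ᶜ` and `ζ'(0) ≠ 0`). [folklore] -/
theorem analyticOrderAt_deriv_riemannZeta_ne_top {ρ : ℂ} (h : ρ ≠ 1) :
    analyticOrderAt (deriv riemannZeta) ρ ≠ ⊤ := by
  intro htop
  have h0 : deriv riemannZeta 0 = 0 :=
    analyticOnNhd_deriv_riemannZeta.eqOn_zero_of_preconnected_of_eventuallyEq_zero
      (isConnected_compl_singleton_of_one_lt_rank (by simp) (1 : ℂ)).isPreconnected h
      (analyticOrderAt_eq_top.mp htop) (show (0 : ℂ) ∈ ({1}ᶜ : Set ℂ) by simp)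
  exact deriv_riemannZeta_zero_ne_zero h0

/-- For `ρ ≠ 1`, the multiplicity of `ρ` as a zero of `ζ'` is positive iff `ζ'(ρ) = 0`. [folklore] -/
theorem derivRiemannZetaZeroOrder_pos_iff {ρ : ℂ} (h : ρ ≠ 1) :
    0 < derivRiemannZetaZeroOrder ρ ↔ deriv riemannZeta ρ = 0 := by
  have ha : AnalyticAt ℂ (deriv riemannZeta) ρ := analyticOnNhd_deriv_riemannZeta ρ h
  obtain ⟨n, hn⟩ := ENat.ne_top_iff_exists.mp (analyticOrderAt_deriv_riemannZeta_ne_top h)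
  have key := ha.analyticOrderAt_eq_zero
  rw [← hn] at key
  rw [derivRiemannZetaZeroOrder, ha.meromorphicOrderAt_eq, ← hn, ENat.map_coe,
    WithTop.untop₀_coe, Int.natCast_pos, Nat.pos_iff_ne_zero, ne_eq,
    ← Nat.cast_eq_zero (R := ℕ∞), key, not_not]

/-- For `ρ ≠ 1`, the multiplicity of `ρ` as a zero of `ζ'` is non-negative. [folklore] -/
theorem derivRiemannZetaZeroOrder_nonneg {ρ : ℂ} (h : ρ ≠ 1) :
    0 ≤ derivRiemannZetaZeroOrder ρ :=
  WithTop.untop₀_nonneg.2 (analyticOnNhd_deriv_riemannZeta ρ h).meromorphicOrderAt_nonneg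

/-! ## Levinson–Montgomery's region `R_T` and the counts `N⁻(T)`, `N₁⁻(T)` -/

/-- The zeros of `ζ` in Levinson–Montgomery's region `R_T`: `0 < Re ρ < 1/2`, `0 < Im ρ < T`
(each listed once; multiplicity `Literature.NumberTheory.LFunctions.riemannZetaZeroOrder`). [cite: LevinsonMontgomery1974, Thm. 1] -/
def zetaLeftBox (T : ℝ) : Set ℂ :=
  {ρ | riemannZeta ρ = 0 ∧ 0 < ρ.re ∧ ρ.re < 1 / 2 ∧ 0 < ρ.im ∧ ρ.im < T}

/-- The zeros of `ζ'` in `R_T`: `0 < Re ρ < 1/2`, `0 < Im ρ < T` (multiplicity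
`derivRiemannZetaZeroOrder`). [cite: LevinsonMontgomery1974, Thm. 1] -/
def derivZetaLeftBox (T : ℝ) : Set ℂ :=
  {ρ | deriv riemannZeta ρ = 0 ∧ 0 < ρ.re ∧ ρ.re < 1 / 2 ∧ 0 < ρ.im ∧ ρ.im < T}

/-- `zetaLeftBox T ⊆ zetaZeroBox 0 T`. [folklore] -/
theorem zetaLeftBox_subset (T : ℝ) : zetaLeftBox T ⊆ Literature.NumberTheory.LFunctions.zetaZeroBox 0 T := by
  rintro ρ ⟨h0, h1, h2, h3, h4⟩
  exact ⟨h0, h1.le, by linarith, h3, h4.le⟩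

/-- `zetaLeftBox T` is finite. [folklore] -/
theorem zetaLeftBox_finite (T : ℝ) : (zetaLeftBox T).Finite :=
  (Literature.NumberTheory.LFunctions.zetaZeroBox_finite 0 T).subset (zetaLeftBox_subset T)

/-- `derivZetaLeftBox T` is finite: it lies in the compact rectangle `[0, 1/2] × [0, T]`, which
avoids the pole `1`, and an accumulation point of zeros of the analytic function `ζ'` would force
`ζ' ≡ 0` on `{1}ᶜ` (identity theorem), contradicting `ζ'(0) ≠ 0`. [folklore] -/
theorem derivZetaLeftBox_finite (T : ℝ) : (derivZetaLeftBox T).Finite := by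
  by_contra hinf
  have hK : IsCompact (Icc (0 : ℝ) (1 / 2) ×ℂ Icc (0 : ℝ) T) := isCompact_Icc.reProdIm isCompact_Icc
  have hsub : derivZetaLeftBox T ⊆ Icc (0 : ℝ) (1 / 2) ×ℂ Icc (0 : ℝ) T := by
    rintro ρ ⟨-, h1, h2, h3, h4⟩
    exact Complex.mem_reProdIm.2 ⟨⟨h1.le, h2.le⟩, h3.le, h4.le⟩
  obtain ⟨z, hzK, hz⟩ := Set.Infinite.exists_accPt_of_subset_isCompact hinf hK hsub
  have hz1 : z ≠ 1 := by
    intro h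
    have := (Complex.mem_reProdIm.1 hzK).1.2
    rw [h] at this
    norm_num at this
  have hfreq : ∃ᶠ w in 𝓝[≠] z, deriv riemannZeta w = 0 :=
    (accPt_iff_frequently_nhdsNE.mp hz).mono fun w hw ↦ hw.1
  have h0 : deriv riemannZeta 0 = 0 :=
    analyticOnNhd_deriv_riemannZeta.eqOn_zero_of_preconnected_of_frequently_eq_zero
      (isConnected_compl_singleton_of_one_lt_rank (by simp) (1 : ℂ)).isPreconnected hz1 hfreq
      (show (0 : ℂ) ∈ ({1}ᶜ : Set ℂ) by simp)
  exact deriv_riemannZeta_zero_ne_zero h0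

/-- `N⁻(T)`: the number of zeros of `ζ` in `R_T = {0 < σ < 1/2, 0 < t < T}`, counted with
multiplicity (a finite sum of positive integers, read in `ℕ`). [cite: LevinsonMontgomery1974, Thm. 1] -/
def zetaLeftCount (T : ℝ) : ℕ :=
  (∑ᶠ ρ ∈ zetaLeftBox T, Literature.NumberTheory.LFunctions.riemannZetaZeroOrder ρ).toNat

/-- `N₁⁻(T)`: the number of zeros of `ζ'` in `R_T = {0 < σ < 1/2, 0 < t < T}`, counted with
multiplicity. [cite: LevinsonMontgomery1974, Thm. 1] -/
def derivZetaLeftCount (T : ℝ) : ℕ :=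
  (∑ᶠ ρ ∈ derivZetaLeftBox T, derivRiemannZetaZeroOrder ρ).toNat

/-- A zero of `ζ` in `R_T` makes `N⁻(T)` positive. [folklore] -/
theorem zetaLeftCount_pos {T : ℝ} {ρ : ℂ} (hρ : ρ ∈ zetaLeftBox T) : 0 < zetaLeftCount T := by
  have hne1 : ∀ ρ' ∈ zetaLeftBox T, ρ' ≠ 1 := by
    rintro ρ' ⟨-, -, h2, -, -⟩ h
    rw [h] at h2
    norm_num at h2
  unfold zetaLeftCount
  rw [Int.lt_toNat, Nat.cast_zero, finsum_mem_eq_finite_toFinset_sum _ (zetaLeftBox_finite T)]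
  refine lt_of_lt_of_le ?_ (Finset.single_le_sum (fun ρ' hρ' ↦ ?_)
    ((zetaLeftBox_finite T).mem_toFinset.2 hρ))
  · exact (Literature.NumberTheory.LFunctions.riemannZetaZeroOrder_pos_iff (hne1 ρ hρ)).2 hρ.1
  · exact Literature.NumberTheory.LFunctions.riemannZetaZeroOrder_nonneg (hne1 ρ' ((zetaLeftBox_finite T).mem_toFinset.1 hρ'))

/-- A zero of `ζ'` in `R_T` makes `N₁⁻(T)` positive. [folklore] -/
theorem derivZetaLeftCount_pos {T : ℝ} {ρ : ℂ} (hρ : ρ ∈ derivZetaLeftBox T) :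
    0 < derivZetaLeftCount T := by
  have hne1 : ∀ ρ' ∈ derivZetaLeftBox T, ρ' ≠ 1 := by
    rintro ρ' ⟨-, -, h2, -, -⟩ h
    rw [h] at h2
    norm_num at h2
  unfold derivZetaLeftCount
  rw [Int.lt_toNat, Nat.cast_zero,
    finsum_mem_eq_finite_toFinset_sum _ (derivZetaLeftBox_finite T)]
  refine lt_of_lt_of_le ?_ (Finset.single_le_sum (fun ρ' hρ' ↦ ?_)
    ((derivZetaLeftBox_finite T).mem_toFinset.2 hρ))
  · exact (derivRiemannZetaZeroOrder_pos_iff (hne1 ρ hρ)).2 hρ.1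
  · exact derivRiemannZetaZeroOrder_nonneg
      (hne1 ρ' ((derivZetaLeftBox_finite T).mem_toFinset.1 hρ'))

/-- If `N₁⁻(T) ≠ 0` then `ζ'` has a zero in `R_T`. [folklore] -/
theorem derivZetaLeftBox_nonempty {T : ℝ} (h : derivZetaLeftCount T ≠ 0) :
    (derivZetaLeftBox T).Nonempty := by
  by_contra hempty
  rw [Set.not_nonempty_iff_eq_empty] at hempty
  apply h
  simp [derivZetaLeftCount, hempty]

/-- Under Mathlib's `RiemannHypothesis`, `R_T` contains no zero of `ζ`, so `N⁻(T) = 0`. [folklore] -/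
theorem zetaLeftCount_eq_zero_of_riemannHypothesis (hRH : RiemannHypothesis) (T : ℝ) :
    zetaLeftCount T = 0 := by
  have hempty : zetaLeftBox T = ∅ := by
    ext ρ
    simp only [Set.mem_empty_iff_false, iff_false]
    rintro ⟨h0, h1, h2, h3, -⟩
    have htriv : ¬∃ n : ℕ, ρ = -2 * (n + 1) := by
      rintro ⟨n, rfl⟩
      simp at h3
    have h1' : ρ ≠ 1 := by
      intro h; rw [h] at h2; norm_num at h2
    have := hRH ρ h0 htriv h1'
    linarith
  simp [zetaLeftCount, hempty]

/-! ## Named facts -/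

/-- **Levinson–Montgomery, Theorem 1, (1.1)** (Acta Math. 133 (1974), p. 49): with `N⁻(T)`,
`N₁⁻(T)` the numbers of zeros of `ζ`, `ζ'` in `R: 0 < t < T, 0 < σ < 1/2`,
`N₁⁻(T) = N⁻(T) + O(log T)`. Zeros are counted with multiplicity, as the argument-principle
proof (LM §2) delivers and as Titchmarsh–Heath-Brown state explicitly at (10.28.2) ("zeros being
counted according to multiplicity"; their (10.28.2) is the variant with `-1 < σ < 1/2` for
`ζ'`). Users take `(h : levinsonMontgomery_thm1_isBigO)`. [cite: LevinsonMontgomery1974, Thm. 1 (1.1)] -/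
def levinsonMontgomery_thm1_isBigO : Prop :=
  (fun T : ℝ ↦ (derivZetaLeftCount T : ℝ) - zetaLeftCount T) =O[atTop] Real.log

/-- **Levinson–Montgomery, Theorem 1, (1.2)** (Acta Math. 133 (1974), p. 49): "Unless
`N⁻(T) > T/2` for all large `T` there exists a sequence `{T_j}`, `T_j → ∞` as `j → ∞` such that
`N₁⁻(T_j) = N⁻(T_j)`" (multiplicities as in (1.1) / Titchmarsh–Heath-Brown (10.28.2)). Users
take `(h : levinsonMontgomery_thm1_seq)`. [cite: LevinsonMontgomery1974, Thm. 1 (1.2)] -/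
def levinsonMontgomery_thm1_seq : Prop :=
  (¬ ∀ᶠ T : ℝ in atTop, T / 2 < (zetaLeftCount T : ℝ)) →
    ∃ u : ℕ → ℝ, Tendsto u atTop atTop ∧ ∀ j, derivZetaLeftCount (u j) = zetaLeftCount (u j)

/-- `ζ` has no zeros on the real axis between `0` and `1`: for `0 < s < 1`,
`(1 − 2^{1−s}) ζ(s) = 1 − 2^{−s} + 3^{−s} − ⋯ > 0` (Titchmarsh (2.12.4)), and `1 − 2^{1−s} ≠ 0`.
Users take `(h : riemannZeta_ne_zero_of_mem_Ioo)`; discharged below by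
`riemannZeta_ne_zero_of_mem_Ioo_holds` (via `Re Λ(σ) < 0`). [cite: Titchmarsh1986, §2.12 (2.12.4)] -/
def riemannZeta_ne_zero_of_mem_Ioo : Prop :=
  ∀ σ : ℝ, 0 < σ → σ < 1 → riemannZeta σ ≠ 0

/-- `ζ'` has no zeros on the real segment `0 < σ < 1/2`: `ζ` is real, negative and strictly
decreasing on `[0, 1)` (`ζ(0) = −1/2`, `ζ'(0) = −½ log 2π`, `ζ(σ) → −∞` as `σ → 1⁻`; the largest
real zero of `ζ'` is `−2.7172…`). This is the `t = 0` case implicit in Levinson–Montgomery's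
Corollary to Theorem 1 ("RH is equivalent to `ζ'(s)` having no zeros in `0 < σ < 1/2`"), whose
Theorem 1 only counts zeros with `t > 0`. Users take
`(h : deriv_riemannZeta_ne_zero_of_mem_Ioo)`; PROVED below,
`deriv_riemannZeta_ne_zero_of_mem_Ioo_holds` (Mellin representation of `Λ`, see the module
docstring), so no citation is load-bearing. [folklore] -/
def deriv_riemannZeta_ne_zero_of_mem_Ioo : Prop :=
  ∀ σ : ℝ, 0 < σ → σ < 1 / 2 → deriv riemannZeta σ ≠ 0

/-! ## Assembly: Speiser's theorem from Levinson–Montgomery's Theorem 1 -/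

/-- Under RH, Theorem 1 (1.2) gives `N₁⁻(T_j) = N⁻(T_j) = 0` along `T_j → ∞`, hence no zero of
`ζ'` in `{0 < σ < 1/2, t > 0}`. [cite: LevinsonMontgomery1974, Cor. to Thm. 1] -/
theorem deriv_riemannZeta_ne_zero_of_riemannHypothesis (h₂ : levinsonMontgomery_thm1_seq)
    (hRH : RiemannHypothesis) {s : ℂ} (h0 : 0 < s.re) (h1 : s.re < 1 / 2) (h2 : 0 < s.im) :
    deriv riemannZeta s ≠ 0 := by
  intro hs
  have hN : ∀ T, zetaLeftCount T = 0 := zetaLeftCount_eq_zero_of_riemannHypothesis hRH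
  have hnot : ¬ ∀ᶠ T : ℝ in atTop, T / 2 < (zetaLeftCount T : ℝ) := by
    intro h
    obtain ⟨T, hT1, hT2⟩ := (h.and (eventually_ge_atTop 0)).exists
    rw [hN T] at hT1
    simp at hT1
    linarith
  obtain ⟨u, hu, hu'⟩ := h₂ hnot
  obtain ⟨j, hj⟩ := (hu.eventually (eventually_gt_atTop s.im)).exists
  have hmem : s ∈ derivZetaLeftBox (u j) := ⟨hs, h0, h1, h2, hj⟩
  have := derivZetaLeftCount_pos hmem
  rw [hu' j, hN] at this
  exact lt_irrefl 0 this

/-- If `ζ` has a zero `ρ` with `0 < Re ρ < 1/2`, `0 < Im ρ`, then Theorem 1 produces a zero of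
`ζ'` in some `R_T`: either `N⁻(T) > T/2` eventually and then `N₁⁻(T) ≥ N⁻(T) − O(log T) > 0`
for large `T` by (1.1), or (1.2) gives `N₁⁻(T_j) = N⁻(T_j) ≥ 1` for `T_j > Im ρ`. [cite: LevinsonMontgomery1974, Cor. to Thm. 1] -/
theorem exists_deriv_riemannZeta_eq_zero_of_zero (h₁ : levinsonMontgomery_thm1_isBigO)
    (h₂ : levinsonMontgomery_thm1_seq) {ρ : ℂ} (hρ : riemannZeta ρ = 0) (h0 : 0 < ρ.re)
    (h1 : ρ.re < 1 / 2) (h2 : 0 < ρ.im) :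
    ∃ s : ℂ, deriv riemannZeta s = 0 ∧ 0 < s.re ∧ s.re < 1 / 2 ∧ 0 < s.im := by
  -- for `T > Im ρ`, `N⁻(T) ≥ 1`
  have hpos : ∀ T, ρ.im < T → 0 < zetaLeftCount T := fun T hT ↦
    zetaLeftCount_pos ⟨hρ, h0, h1, h2, hT⟩
  -- it suffices to find `T` with `N₁⁻(T) ≠ 0`
  suffices ∃ T, derivZetaLeftCount T ≠ 0 by
    obtain ⟨T, hT⟩ := this
    obtain ⟨s, hs, hs0, hs1, hs2, -⟩ := derivZetaLeftBox_nonempty hT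
    exact ⟨s, hs, hs0, hs1, hs2⟩
  by_cases hev : ∀ᶠ T : ℝ in atTop, T / 2 < (zetaLeftCount T : ℝ)
  · -- (1.1): `|N₁⁻ − N⁻| ≤ C log T`, and `C log T ≤ T/4` for large `T`
    obtain ⟨C, hC⟩ := h₁.bound
    have hlog : ∀ᶠ T : ℝ in atTop, C * ‖Real.log T‖ ≤ T / 4 := by
      have hC' : 0 < |C| + 1 := by positivity
      have := Real.isLittleO_log_id_atTop.def (c := 1 / (4 * (|C| + 1))) (by positivity)
      filter_upwards [this, eventually_ge_atTop (0 : ℝ)] with T hT hT0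
      have hlogT : ‖Real.log T‖ ≤ 1 / (4 * (|C| + 1)) * T := by simpa [abs_of_nonneg hT0] using hT
      calc C * ‖Real.log T‖ ≤ (|C| + 1) * ‖Real.log T‖ := by
            gcongr; exact (le_abs_self C).trans (le_add_of_nonneg_right zero_le_one)
        _ ≤ (|C| + 1) * (1 / (4 * (|C| + 1)) * T) := by gcongr
        _ = T / 4 := by field_simp
    obtain ⟨T, hT⟩ := (hev.and (hC.and (hlog.and (eventually_gt_atTop (0 : ℝ))))).exists
    obtain ⟨hT1, hT2, hT3, hT4⟩ := hT
    refine ⟨T, fun hz ↦ ?_⟩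
    rw [hz] at hT2
    simp only [CharP.cast_eq_zero, zero_sub, norm_neg] at hT2
    have hN : ((zetaLeftCount T : ℕ) : ℝ) ≤ C * ‖Real.log T‖ := by
      calc ((zetaLeftCount T : ℕ) : ℝ) = ‖((zetaLeftCount T : ℕ) : ℝ)‖ := by
            rw [Real.norm_of_nonneg (Nat.cast_nonneg _)]
        _ ≤ C * ‖Real.log T‖ := hT2
    linarith
  · obtain ⟨u, hu, hu'⟩ := h₂ hev
    obtain ⟨j, hj⟩ := (hu.eventually (eventually_gt_atTop ρ.im)).exists
    exact ⟨u j, by rw [hu' j]; exact (hpos (u j) hj).ne'⟩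

/-- **Assembly of Speiser's theorem** (`Literature.NumberTheory.LFunctions.speiser_iff`, rh.S18) from Levinson–Montgomery's
Theorem 1 ((1.1) `levinsonMontgomery_thm1_isBigO`, (1.2) `levinsonMontgomery_thm1_seq`) and the
classical facts that the non-trivial zeros lie in the open strip
(`Literature.NumberTheory.LFunctions.mem_riemannZetaNontrivialZeros_iff`), that `ζ(σ) ≠ 0` for real `0 < σ < 1`
(`riemannZeta_ne_zero_of_mem_Ioo`) and that `ζ'(σ) ≠ 0` for real `0 < σ < 1/2`
(`deriv_riemannZeta_ne_zero_of_mem_Ioo`); the lower half-plane is reached by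
`deriv_riemannZeta_conj`/`riemannZeta_conj`, the right half of the strip by the functional
equation (`riemannZeta_one_sub_eq_zero`). This is the proof of the Corollary on p. 49 of
Levinson–Montgomery. [cite: LevinsonMontgomery1974, Cor. to Thm. 1] -/
theorem speiser_iff_of_levinsonMontgomery (h₁ : levinsonMontgomery_thm1_isBigO)
    (h₂ : levinsonMontgomery_thm1_seq) (h₃ : Literature.NumberTheory.LFunctions.mem_riemannZetaNontrivialZeros_iff)
    (h₄ : riemannZeta_ne_zero_of_mem_Ioo) (h₅ : deriv_riemannZeta_ne_zero_of_mem_Ioo) :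
    speiser_iff := by
  constructor
  · -- RH ⇒ no zeros of ζ' in the open left half-strip
    intro hRH s hs0 hs1
    rcases lt_trichotomy s.im 0 with him | him | him
    · -- lower half-plane: conjugate
      intro hs
      have h' : deriv riemannZeta (conj s) = 0 := by rw [deriv_riemannZeta_conj, hs, map_zero]
      exact deriv_riemannZeta_ne_zero_of_riemannHypothesis h₂ hRH (s := conj s)
        (by simpa using hs0) (by simpa using hs1) (by simpa using him) h'
    · -- real axis
      have hs : s = (s.re : ℂ) := by
        apply Complex.ext <;> simp [him]
      rw [hs]
      exact h₅ s.re hs0 hs1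
    · exact deriv_riemannZeta_ne_zero_of_riemannHypothesis h₂ hRH hs0 hs1 him
  · -- no zeros of ζ' in the open left half-strip ⇒ RH
    intro hno s hs htriv hs1
    by_contra hre
    -- `s` is a non-trivial zero, hence in the open strip
    have hmem : s ∈ Literature.NumberTheory.LFunctions.ZetaZeros.riemannZetaNontrivialZeros := by
      refine ⟨hs, ?_⟩
      rintro ⟨n, hn⟩
      exact htriv ⟨n, hn.symm⟩
    obtain ⟨-, h0, h1⟩ := h₃.1 hmem
    -- not real
    have him : s.im ≠ 0 := by
      intro him
      have hs' : s = (s.re : ℂ) := by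
        apply Complex.ext <;> simp [him]
      rw [hs'] at hs
      exact h₄ s.re h0 h1 hs
    -- produce a zero `ρ` with `0 < Re ρ < 1/2` and `0 < Im ρ`
    have key : ∃ ρ : ℂ, riemannZeta ρ = 0 ∧ 0 < ρ.re ∧ ρ.re < 1 / 2 ∧ 0 < ρ.im := by
      -- first arrange `Re < 1/2`
      have step : ∃ ρ : ℂ, riemannZeta ρ = 0 ∧ 0 < ρ.re ∧ ρ.re < 1 / 2 ∧ ρ.im ≠ 0 := by
        rcases lt_or_gt_of_ne hre with hlt | hgt
        · exact ⟨s, hs, h0, hlt, him⟩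
        · refine ⟨1 - s, LevinsonMontgomery.riemannZeta_one_sub_eq_zero h0 hs, ?_, ?_, ?_⟩
          · simp; linarith
          · simp; linarith
          · simpa using him
      obtain ⟨ρ, hρ, hρ0, hρ1, hρim⟩ := step
      rcases lt_or_gt_of_ne hρim with hlt | hgt
      · refine ⟨conj ρ, by rw [riemannZeta_conj, hρ, map_zero], by simpa using hρ0,
          by simpa using hρ1, by simpa using hlt⟩
      · exact ⟨ρ, hρ, hρ0, hρ1, hgt⟩
    obtain ⟨ρ, hρ, hρ0, hρ1, hρ2⟩ := key
    obtain ⟨s', hs', hs'0, hs'1, -⟩ :=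
      exists_deriv_riemannZeta_eq_zero_of_zero h₁ h₂ hρ hρ0 hρ1 hρ2
    exact hno s' hs'0 hs'1 hs'


/-! ## Discharges of the real-axis leaves (section `RealZeros`)

`E := completedRiemannZeta₀`, `Λ := completedRiemannZeta = E − 1/s − 1/(1−s)`,
`ζ = Λ/Γℝ` away from `0`. Everything rests on Mathlib's construction
`E(s) = ½ · mellin (hurwitzEvenFEPair 0).f_modif (s/2)` and on the fact, proved here, that this
modified theta kernel is real and non-negative. -/

namespace RealZeros

open MeasureTheory HurwitzZeta


/-- The (real, non-negative) modified theta kernel whose Mellin transform is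
`2 · completedRiemannZeta₀ (2s)`: `θ(x) − 1` for `x > 1`, `θ(x) − x^{-1/2}` for `0 < x < 1`,
`θ(x) = Σ_{n ∈ ℤ} e^{−π n² x}`. [folklore] -/
def kernel (x : ℝ) : ℝ :=
  (Ioi 1).indicator (fun x ↦ evenKernel 0 x - 1) x +
    (Ioo 0 1).indicator (fun x ↦ evenKernel 0 x - x ^ (-(1 / 2 : ℝ))) x

/-- `θ(t) ≥ 1` for `t > 0`: `θ(t) − 1 = Σ_{n ≠ 0} e^{−π n² t} ≥ 0` (`hasSum_int_evenKernel₀`). [folklore] -/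
theorem one_le_evenKernel_zero {t : ℝ} (ht : 0 < t) : 1 ≤ evenKernel 0 t := by
  have h := hasSum_int_evenKernel₀ 0 ht
  simp only [add_zero, QuotientAddGroup.mk_zero, if_true] at h
  have : 0 ≤ evenKernel 0 t - 1 :=
    h.nonneg fun n ↦ by split_ifs <;> positivity
  linarith

/-- `θ(x) − x^{−1/2} = x^{−1/2}(θ(1/x) − 1) ≥ 0` for `x > 0` (theta transformation formula `evenKernel_functional_equation`). [folklore] -/
theorem evenKernel_zero_sub_rpow_nonneg {x : ℝ} (hx : 0 < x) :
    0 ≤ evenKernel 0 x - x ^ (-(1 / 2 : ℝ)) := by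
  rw [evenKernel_functional_equation, ← evenKernel_eq_cosKernel_of_zero]
  have h1 : 1 ≤ evenKernel 0 (1 / x) := one_le_evenKernel_zero (by positivity)
  have hx' : 0 < x ^ (1 / 2 : ℝ) := by positivity
  have : 1 / x ^ (1 / 2 : ℝ) * evenKernel 0 (1 / x) - x ^ (-(1 / 2 : ℝ)) =
      (1 / x ^ (1 / 2 : ℝ)) * (evenKernel 0 (1 / x) - 1) := by
    rw [Real.rpow_neg hx.le]
    ring
  rw [this]
  exact mul_nonneg (by positivity) (by linarith)

/-- The modified theta kernel is non-negative. [folklore] -/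
theorem kernel_nonneg (x : ℝ) : 0 ≤ kernel x := by
  unfold kernel
  refine add_nonneg (Set.indicator_nonneg (fun t ht ↦ ?_) x)
    (Set.indicator_nonneg (fun t ht ↦ ?_) x)
  · have := one_le_evenKernel_zero (show (0 : ℝ) < t from lt_trans one_pos ht)
    linarith
  · exact evenKernel_zero_sub_rpow_nonneg ht.1

/-- Mathlib's `(hurwitzEvenFEPair 0).f_modif` is the real kernel `RealZeros.kernel` (unfolding `f = θ`, `f₀ = g₀ = 1`, `ε = 1`, `k = 1/2`). [folklore] -/
theorem f_modif_eq (x : ℝ) : (hurwitzEvenFEPair 0).f_modif x = (kernel x : ℂ) := by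
  simp only [WeakFEPair.f_modif, hurwitzEvenFEPair, kernel, Pi.add_apply, Set.indicator_apply,
    Set.mem_Ioi, Set.mem_Ioo, Function.comp_apply, if_true, one_mul, smul_eq_mul, mul_one]
  push_cast
  split_ifs <;> simp

/-- `2 E(σ) = ∫₀^∞ t^{σ/2-1} kernel(t) dt` is a convergent Mellin integral for every real `σ`. [folklore] -/
theorem mellinConvergent_kernel (s : ℂ) :
    MellinConvergent (fun x ↦ (kernel x : ℂ)) s := by
  have h := ((hurwitzEvenFEPair 0).isStrongFEPair_toStrongFEPair.hasMellin s).1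
  have hf : (hurwitzEvenFEPair 0).toStrongFEPair.f = fun x ↦ (kernel x : ℂ) := by
    funext x
    exact f_modif_eq x
  rwa [hf] at h

/-- `E(s) = completedRiemannZeta₀ s = ½ · mellin kernel (s/2)` (Mathlib's definition, with the kernel made explicit). [folklore] -/
theorem completedRiemannZeta₀_eq_mellin (s : ℂ) :
    completedRiemannZeta₀ s = mellin (fun x ↦ (kernel x : ℂ)) (s / 2) / 2 := by
  rw [completedRiemannZeta₀, completedHurwitzZetaEven₀, WeakFEPair.Λ₀]
  congr 2
  funext x
  exact f_modif_eq x

/-- The real integrand. [folklore] -/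
theorem integrableOn_kernel (σ : ℝ) :
    IntegrableOn (fun t : ℝ ↦ t ^ (σ / 2 - 1) * kernel t) (Ioi 0) := by
  have h := (mellinConvergent_kernel (σ / 2 : ℝ)).re
  refine IntegrableOn.congr_fun h (fun t ht ↦ ?_) measurableSet_Ioi
  simp only [smul_eq_mul, RCLike.re_to_complex]
  rw [show ((σ / 2 : ℝ) : ℂ) - 1 = ((σ / 2 - 1 : ℝ) : ℂ) by push_cast; ring,
    ← Complex.ofReal_cpow (le_of_lt ht), ← Complex.ofReal_mul, Complex.ofReal_re]

/-- For real `σ`, `Re E(σ) = ½ ∫₀^∞ t^{σ/2−1} kernel(t) dt` as a real integral. [folklore] -/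
theorem re_completedRiemannZeta₀_ofReal (σ : ℝ) :
    (completedRiemannZeta₀ σ).re = (∫ t in Ioi (0 : ℝ), t ^ (σ / 2 - 1) * kernel t) / 2 := by
  rw [completedRiemannZeta₀_eq_mellin, div_ofNat_re, mellin]
  congr 1
  have hconv := mellinConvergent_kernel ((σ : ℂ) / 2)
  have hre := integral_re hconv
  simp only [RCLike.re_to_complex] at hre
  rw [← hre]
  refine setIntegral_congr_fun measurableSet_Ioi (fun t ht ↦ ?_)
  simp only [smul_eq_mul]
  rw [show (σ : ℂ) / 2 - 1 = ((σ / 2 - 1 : ℝ) : ℂ) by push_cast; ring,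
    ← Complex.ofReal_cpow (le_of_lt ht), ← Complex.ofReal_mul, Complex.ofReal_re]

/-- Kernel non-negativity gives `E(σ) ≤ E(0) + E(1)` for `0 < σ < 1`. [folklore] -/
theorem re_completedRiemannZeta₀_le {σ : ℝ} (h0 : 0 < σ) (h1 : σ < 1) :
    (completedRiemannZeta₀ σ).re ≤
      (completedRiemannZeta₀ (0 : ℝ)).re + (completedRiemannZeta₀ (1 : ℝ)).re := by
  rw [re_completedRiemannZeta₀_ofReal, re_completedRiemannZeta₀_ofReal,
    re_completedRiemannZeta₀_ofReal, ← add_div, ← integral_add (integrableOn_kernel 0)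
    (integrableOn_kernel 1)]
  refine div_le_div_of_nonneg_right ?_ (by norm_num)
  refine setIntegral_mono_on (integrableOn_kernel σ)
    ((integrableOn_kernel 0).add (integrableOn_kernel 1)) measurableSet_Ioi (fun t ht ↦ ?_)
  rw [← add_mul]
  refine mul_le_mul_of_nonneg_right ?_ (kernel_nonneg t)
  have ht : (0 : ℝ) < t := ht
  rcases le_or_gt 1 t with h | h
  · calc t ^ (σ / 2 - 1) ≤ t ^ ((1 : ℝ) / 2 - 1) :=
          Real.rpow_le_rpow_of_exponent_le h (by linarith)
      _ ≤ t ^ ((0 : ℝ) / 2 - 1) + t ^ ((1 : ℝ) / 2 - 1) :=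
          le_add_of_nonneg_left (by positivity)
  · calc t ^ (σ / 2 - 1) ≤ t ^ ((0 : ℝ) / 2 - 1) :=
          Real.rpow_le_rpow_of_exponent_ge ht h.le (by linarith)
      _ ≤ t ^ ((0 : ℝ) / 2 - 1) + t ^ ((1 : ℝ) / 2 - 1) :=
          le_add_of_nonneg_right (by positivity)

/-- `E(0) = E(1) = (γ − log 4π)/2 + 1 < 1/3`. [folklore] -/
theorem re_completedRiemannZeta₀_one_lt : (completedRiemannZeta₀ (1 : ℝ)).re < 1 / 3 := by
  rw [Complex.ofReal_one, completedRiemannZeta₀_one]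
  have hlog : Complex.log (4 * π) = (Real.log (4 * π) : ℂ) := by
    rw [Complex.ofReal_log (by positivity)]
    push_cast
    rfl
  rw [hlog]
  simp only [add_re, div_ofNat_re, sub_re, ofReal_re, one_re]
  have hγ := Real.eulerMascheroniConstant_lt_two_thirds
  have h4π : (2 : ℝ) < Real.log (4 * π) := by
    rw [Real.lt_log_iff_exp_lt (by positivity)]
    have he : Real.exp 2 < 2.7182818286 ^ 2 := by
      rw [show (2 : ℝ) = 1 + 1 by norm_num, Real.exp_add, sq]
      exact mul_lt_mul'' Real.exp_one_lt_d9 Real.exp_one_lt_d9 (Real.exp_pos _).le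
        (Real.exp_pos _).le
    have : (2.7182818286 : ℝ) ^ 2 < 4 * π := by nlinarith [Real.pi_gt_three]
    linarith
  linarith

/-- `E(0) = E(1)` (functional equation `completedRiemannZeta₀_one_sub`). [folklore] -/
theorem re_completedRiemannZeta₀_zero_eq :
    (completedRiemannZeta₀ (0 : ℝ)).re = (completedRiemannZeta₀ (1 : ℝ)).re := by
  have := completedRiemannZeta₀_one_sub 1
  rw [sub_self] at this
  rw [Complex.ofReal_zero, Complex.ofReal_one, this]

/-- For real `0 < σ < 1`, `Re Λ(σ) < 0` where `Λ = completedRiemannZeta`. [folklore] -/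
theorem re_completedRiemannZeta_neg {σ : ℝ} (h0 : 0 < σ) (h1 : σ < 1) :
    (completedRiemannZeta σ).re < 0 := by
  rw [completedRiemannZeta_eq]
  have hE := re_completedRiemannZeta₀_le h0 h1
  rw [re_completedRiemannZeta₀_zero_eq] at hE
  have h3 := re_completedRiemannZeta₀_one_lt
  have hσ : (1 / (σ : ℂ)).re = 1 / σ := by
    rw [← Complex.ofReal_one, ← Complex.ofReal_div, Complex.ofReal_re]
  have hσ' : (1 / (1 - (σ : ℂ))).re = 1 / (1 - σ) := by
    rw [← Complex.ofReal_one, ← Complex.ofReal_sub, ← Complex.ofReal_div, Complex.ofReal_re]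
  simp only [sub_re, hσ, hσ']
  have h4 : 1 ≤ 1 / σ := by rw [le_div_iff₀ h0]; linarith
  have h5 : 1 ≤ 1 / (1 - σ) := by rw [le_div_iff₀ (by linarith)]; linarith
  linarith


/-! ### Real digamma: identification and a monotonicity bound -/

/-- A positive real, coerced to `ℂ`, is not `−m`, `m ∈ ℕ` (no pole of `Γ`). [folklore] -/
theorem natCast_ne_ofReal_neg {x : ℝ} (hx : 0 < x) (m : ℕ) : (x : ℂ) ≠ -m := by
  intro h
  have := congrArg Complex.re h
  simp at this
  have : (0 : ℝ) ≤ m := m.cast_nonneg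
  linarith

/-- A positive real is not `−m`, `m ∈ ℕ`. [folklore] -/
theorem real_ne_neg_nat {x : ℝ} (hx : 0 < x) (m : ℕ) : x ≠ -m := by
  intro h
  have : (0 : ℝ) ≤ m := m.cast_nonneg
  linarith

/-- At real `x > 0`, `ψ(x) = Γ'(x)/Γ(x)` computed with the real Gamma function. [folklore] -/
theorem digamma_ofReal {x : ℝ} (hx : 0 < x) :
    Complex.digamma (x : ℂ) = ((deriv Real.Gamma x / Real.Gamma x : ℝ) : ℂ) := by
  have h1 : HasDerivAt (fun y : ℝ ↦ Complex.Gamma (y : ℂ)) (deriv Complex.Gamma x) x :=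
    (Complex.differentiableAt_Gamma _ (natCast_ne_ofReal_neg hx)).hasDerivAt.comp_ofReal
  have h2 : HasDerivAt (fun y : ℝ ↦ (Real.Gamma y : ℂ)) ((deriv Real.Gamma x : ℝ) : ℂ) x :=
    (Real.differentiableAt_Gamma (real_ne_neg_nat hx)).hasDerivAt.ofReal_comp
  have heq : (fun y : ℝ ↦ Complex.Gamma (y : ℂ)) = fun y ↦ (Real.Gamma y : ℂ) := by
    funext y
    exact Complex.Gamma_ofReal y
  rw [heq] at h1
  have h3 := h1.unique h2
  rw [Complex.digamma_def, logDeriv_apply, h3, Complex.Gamma_ofReal, ← Complex.ofReal_div]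

/-- `(log Γ)'(x) = Γ'(x)/Γ(x)` for real `x > 0`. [folklore] -/
theorem deriv_log_Gamma_eq {x : ℝ} (hx : 0 < x) :
    deriv (Real.log ∘ Real.Gamma) x = deriv Real.Gamma x / Real.Gamma x := by
  show deriv (fun y ↦ Real.log (Real.Gamma y)) x = _
  exact deriv.log (Real.differentiableAt_Gamma (real_ne_neg_nat hx)) (Real.Gamma_pos_of_pos hx).ne'

/-- The real digamma `(log Γ)'` is monotone on `(0, ∞)` (`log Γ` is convex, Bohr–Mollerup: `Real.convexOn_log_Gamma`). [folklore] -/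
theorem monotoneOn_deriv_log_Gamma : MonotoneOn (deriv (Real.log ∘ Real.Gamma)) (Ioi 0) :=
  Real.convexOn_log_Gamma.monotoneOn_deriv fun x hx ↦
    show DifferentiableAt ℝ (fun y ↦ Real.log (Real.Gamma y)) x from
      (Real.differentiableAt_Gamma (real_ne_neg_nat hx)).log (Real.Gamma_pos_of_pos hx).ne'

/-- `ψ(2) = 1 − γ` (`ψ(1) = −γ` and `ψ(s+1) = ψ(s) + 1/s`). [folklore] -/
theorem digamma_two : Complex.digamma 2 = 1 - Real.eulerMascheroniConstant := by
  have h := Complex.digamma_apply_add_one 1 (fun m hm ↦ by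
    have := congrArg Complex.re hm
    simp at this
    have : (0 : ℝ) ≤ m := m.cast_nonneg
    linarith)
  rw [one_add_one_eq_two, Complex.digamma_one, inv_one] at h
  rw [h]
  ring

/-- `Re ψ(x) ≤ ψ(2) = 1 − γ` for real `0 < x ≤ 2` (`log Γ` is convex). [folklore] -/
theorem re_digamma_ofReal_le {x : ℝ} (h0 : 0 < x) (h2 : x ≤ 2) :
    (Complex.digamma x).re ≤ 1 - Real.eulerMascheroniConstant := by
  have hx := digamma_ofReal h0
  have htwo := digamma_ofReal (show (0 : ℝ) < 2 by norm_num)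
  rw [Complex.ofReal_ofNat, digamma_two] at htwo
  have hmono := monotoneOn_deriv_log_Gamma (mem_Ioi.2 h0) (mem_Ioi.2 (by norm_num : (0:ℝ) < 2)) h2
  rw [deriv_log_Gamma_eq h0, deriv_log_Gamma_eq (by norm_num)] at hmono
  have h2re := congrArg Complex.re htwo
  simp only [Complex.ofReal_re, Complex.sub_re, Complex.one_re] at h2re
  rw [hx, Complex.ofReal_re]
  linarith

/-! ### Derivative of `Γℝ` -/

/-- `Γℝ'(s) = Γℝ(s) · (−½ log π + ½ ψ(s/2))` away from the poles (`Γℝ(s) = π^{−s/2} Γ(s/2)`,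
`ψ = Γ'/Γ = Complex.digamma`). [folklore] -/
theorem hasDerivAt_Gammaℝ {s : ℂ} (hs : ∀ m : ℕ, s / 2 ≠ -m) :
    HasDerivAt Gammaℝ
      (Gammaℝ s * (-(Complex.log π) / 2 + Complex.digamma (s / 2) / 2)) s := by
  have hπ : (π : ℂ) ≠ 0 := by exact_mod_cast Real.pi_ne_zero
  have hlin : HasDerivAt (fun z : ℂ ↦ -z / 2) (-1 / 2 : ℂ) s := (hasDerivAt_neg s).div_const 2
  have h1 : HasDerivAt (fun z : ℂ ↦ (π : ℂ) ^ (-z / 2))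
      ((π : ℂ) ^ (-s / 2) * Complex.log π * (-1 / 2)) s :=
    hlin.const_cpow (Or.inl hπ)
  have hlin2 : HasDerivAt (fun z : ℂ ↦ z / 2) (1 / 2 : ℂ) s := (hasDerivAt_id' s).div_const 2
  have h2 : HasDerivAt (fun z : ℂ ↦ Complex.Gamma (z / 2))
      (deriv Complex.Gamma (s / 2) * (1 / 2)) s :=
    (Complex.differentiableAt_Gamma _ hs).hasDerivAt.comp s hlin2
  have h3 : HasDerivAt (fun z : ℂ ↦ (π : ℂ) ^ (-z / 2) * Complex.Gamma (z / 2))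
      ((π : ℂ) ^ (-s / 2) * Complex.log π * (-1 / 2) * Complex.Gamma (s / 2) +
        (π : ℂ) ^ (-s / 2) * (deriv Complex.Gamma (s / 2) * (1 / 2))) s := h1.mul h2
  have hG : Complex.Gamma (s / 2) ≠ 0 := Complex.Gamma_ne_zero hs
  have hderiv : deriv Complex.Gamma (s / 2) = Complex.digamma (s / 2) * Complex.Gamma (s / 2) := by
    rw [Complex.digamma_def, logDeriv_apply, div_mul_cancel₀ _ hG]
  have hfun : Gammaℝ = fun z : ℂ ↦ (π : ℂ) ^ (-z / 2) * Complex.Gamma (z / 2) := by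
    funext z
    exact Gammaℝ_def z
  rw [hfun]
  refine h3.congr_deriv ?_
  rw [hderiv]
  simp only
  ring

/-! ### `E(2) = π/6 − 1/2` -/

/-- `Λ(2) = ζ(2) Γℝ(2) = (π²/6) · π⁻¹ = π/6`. [folklore] -/
theorem completedRiemannZeta_two : completedRiemannZeta 2 = π / 6 := by
  have hz := riemannZeta_def_of_ne_zero (s := 2) two_ne_zero
  have hG : Gammaℝ 2 = (π : ℂ)⁻¹ := by
    rw [Gammaℝ_def, show (-2 : ℂ) / 2 = -1 by norm_num, show (2 : ℂ) / 2 = 1 by norm_num,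
      Complex.Gamma_one, mul_one, Complex.cpow_neg_one]
  have hπ : (π : ℂ) ≠ 0 := by exact_mod_cast Real.pi_ne_zero
  rw [hG, riemannZeta_two, div_inv_eq_mul] at hz
  field_simp at hz
  rw [hz]
  ring

/-- `E(2) = Λ(2) + 1/2 + 1/(1−2) = π/6 − 1/2`. [folklore] -/
theorem completedRiemannZeta₀_two : completedRiemannZeta₀ 2 = π / 6 - 1 / 2 := by
  have h := completedRiemannZeta_eq 2
  rw [completedRiemannZeta_two, show (1 : ℂ) - 2 = -1 by norm_num] at h
  linear_combination -h

/-- `E(2) = π/6 − 1/2 < 1/6` (`π < 4`). [folklore] -/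
theorem re_completedRiemannZeta₀_two_lt : (completedRiemannZeta₀ (2 : ℝ)).re < 1 / 6 := by
  rw [Complex.ofReal_ofNat, completedRiemannZeta₀_two]
  have h : ((π : ℂ) / 6 - 1 / 2).re = π / 6 - 1 / 2 := by
    rw [← Complex.ofReal_ofNat 6, ← Complex.ofReal_div, ← Complex.ofReal_one,
      ← Complex.ofReal_ofNat 2, ← Complex.ofReal_div, ← Complex.ofReal_sub, Complex.ofReal_re]
  rw [h]
  linarith [Real.pi_lt_four]


/-! ### `E'` as a Mellin integral and its bound -/

/-- The kernel is locally integrable on `(0, ∞)` (`WeakFEPair.hf_modif_int`). [folklore] -/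
theorem locallyIntegrableOn_kernel :
    LocallyIntegrableOn (fun x ↦ (kernel x : ℂ)) (Ioi 0) := by
  have h := (hurwitzEvenFEPair 0).hf_modif_int
  have hf : (hurwitzEvenFEPair 0).f_modif = fun x ↦ (kernel x : ℂ) := funext f_modif_eq
  rwa [hf] at h

/-- The kernel decays faster than any power at `∞` (strong FE-pair `toStrongFEPair`). [folklore] -/
theorem kernel_isBigO_atTop (r : ℝ) : (fun x ↦ (kernel x : ℂ)) =O[atTop] (· ^ r) := by
  have h := (hurwitzEvenFEPair 0).isStrongFEPair_toStrongFEPair.hf_top r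
  have hf : (hurwitzEvenFEPair 0).toStrongFEPair.f = fun x ↦ (kernel x : ℂ) := funext f_modif_eq
  rwa [hf] at h

/-- The kernel decays faster than any power at `0⁺` (strong FE-pair `toStrongFEPair`). [folklore] -/
theorem kernel_isBigO_nhds_zero (r : ℝ) : (fun x ↦ (kernel x : ℂ)) =O[𝓝[>] 0] (· ^ r) := by
  have h := (hurwitzEvenFEPair 0).isStrongFEPair_toStrongFEPair.hf_zero r
  have hf : (hurwitzEvenFEPair 0).toStrongFEPair.f = fun x ↦ (kernel x : ℂ) := funext f_modif_eq
  rwa [hf] at h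

/-- Differentiation under the Mellin integral: `E'(s) = ¼ ∫₀^∞ t^{s/2-1} log t · kernel(t) dt`. [folklore] -/
theorem hasDerivAt_completedRiemannZeta₀ (s : ℂ) :
    MellinConvergent (fun t ↦ Real.log t • (kernel t : ℂ)) (s / 2) ∧
    HasDerivAt completedRiemannZeta₀
      (mellin (fun t ↦ Real.log t • (kernel t : ℂ)) (s / 2) / 4) s := by
  have hm := mellin_hasDerivAt_of_isBigO_rpow (E := ℂ) (a := (s / 2).re + 1) (b := (s / 2).re - 1)
    (f := fun t ↦ (kernel t : ℂ)) (s := s / 2) locallyIntegrableOn_kernel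
    (kernel_isBigO_atTop _) (by linarith) (kernel_isBigO_nhds_zero _) (by linarith)
  refine ⟨hm.1, ?_⟩
  have hfun : completedRiemannZeta₀ = fun s ↦ mellin (fun x ↦ (kernel x : ℂ)) (s / 2) / 2 :=
    funext completedRiemannZeta₀_eq_mellin
  rw [hfun]
  have hlin : HasDerivAt (fun z : ℂ ↦ z / 2) (1 / 2 : ℂ) s := (hasDerivAt_id' s).div_const 2
  have h2 := (hm.2.comp s hlin).div_const 2
  refine h2.congr_deriv ?_
  ring

/-- `|log t| ≤ 2 (t^{1/2} + t^{-1/2})` for `t > 0`. [folklore] -/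
theorem abs_log_le {t : ℝ} (ht : 0 < t) :
    |Real.log t| ≤ 2 * (t ^ (1 / 2 : ℝ) + t ^ (-(1 / 2) : ℝ)) := by
  have h1 : Real.log t ≤ t ^ (1 / 2 : ℝ) / (1 / 2) := Real.log_le_rpow_div ht.le one_half_pos
  have h2 : Real.log t⁻¹ ≤ t⁻¹ ^ (1 / 2 : ℝ) / (1 / 2) :=
    Real.log_le_rpow_div (inv_nonneg.2 ht.le) one_half_pos
  rw [Real.log_inv, Real.inv_rpow ht.le, ← Real.rpow_neg ht.le] at h2
  have h3 : 0 ≤ t ^ (1 / 2 : ℝ) := by positivity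
  have h4 : 0 ≤ t ^ (-(1 / 2) : ℝ) := by positivity
  rw [abs_le]
  constructor <;> linarith

/-- The majorant used for `|E'|`. [folklore] -/
theorem pointwise_bound {σ t : ℝ} (h0 : 0 < σ) (h1 : σ < 1) (ht : 0 < t) :
    t ^ (σ / 2 - 1) * |Real.log t| * kernel t ≤
      2 * (t ^ ((1 : ℝ) / 2 - 1) + t ^ ((-1 : ℝ) / 2 - 1) + t ^ ((2 : ℝ) / 2 - 1)
        + t ^ ((0 : ℝ) / 2 - 1)) * kernel t := by
  refine mul_le_mul_of_nonneg_right ?_ (kernel_nonneg t)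
  have hpow : t ^ (σ / 2 - 1) ≤ t ^ ((0 : ℝ) / 2 - 1) + t ^ ((1 : ℝ) / 2 - 1) := by
    rcases le_or_gt 1 t with h | h
    · calc t ^ (σ / 2 - 1) ≤ t ^ ((1 : ℝ) / 2 - 1) :=
            Real.rpow_le_rpow_of_exponent_le h (by linarith)
        _ ≤ t ^ ((0 : ℝ) / 2 - 1) + t ^ ((1 : ℝ) / 2 - 1) :=
            le_add_of_nonneg_left (by positivity)
    · calc t ^ (σ / 2 - 1) ≤ t ^ ((0 : ℝ) / 2 - 1) :=
            Real.rpow_le_rpow_of_exponent_ge ht h.le (by linarith)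
        _ ≤ t ^ ((0 : ℝ) / 2 - 1) + t ^ ((1 : ℝ) / 2 - 1) :=
            le_add_of_nonneg_right (by positivity)
  have hlog := abs_log_le ht
  calc t ^ (σ / 2 - 1) * |Real.log t|
      ≤ (t ^ ((0 : ℝ) / 2 - 1) + t ^ ((1 : ℝ) / 2 - 1)) *
          (2 * (t ^ (1 / 2 : ℝ) + t ^ (-(1 / 2) : ℝ))) :=
        mul_le_mul hpow hlog (abs_nonneg _) (by positivity)
    _ = 2 * (t ^ ((1 : ℝ) / 2 - 1) + t ^ ((-1 : ℝ) / 2 - 1) + t ^ ((2 : ℝ) / 2 - 1)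
        + t ^ ((0 : ℝ) / 2 - 1)) := by
        have e1 : t ^ ((0 : ℝ) / 2 - 1) * t ^ (1 / 2 : ℝ) = t ^ ((1 : ℝ) / 2 - 1) := by
          rw [← Real.rpow_add ht]; norm_num
        have e2 : t ^ ((0 : ℝ) / 2 - 1) * t ^ (-(1 / 2) : ℝ) = t ^ ((-1 : ℝ) / 2 - 1) := by
          rw [← Real.rpow_add ht]; norm_num
        have e3 : t ^ ((1 : ℝ) / 2 - 1) * t ^ (1 / 2 : ℝ) = t ^ ((2 : ℝ) / 2 - 1) := by
          rw [← Real.rpow_add ht]; norm_num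
        have e4 : t ^ ((1 : ℝ) / 2 - 1) * t ^ (-(1 / 2) : ℝ) = t ^ ((0 : ℝ) / 2 - 1) := by
          rw [← Real.rpow_add ht]; norm_num
        linear_combination (2 : ℝ) * (e1 + e2 + e3 + e4)

/-- `‖E'(σ)‖ ≤ E(1) + E(−1) + E(2) + E(0)` (real parts) for `0 < σ < 1`. [folklore] -/
theorem norm_deriv_completedRiemannZeta₀_le {σ : ℝ} (h0 : 0 < σ) (h1 : σ < 1) :
    ‖deriv completedRiemannZeta₀ σ‖ ≤
      (completedRiemannZeta₀ (1 : ℝ)).re + (completedRiemannZeta₀ (-1 : ℝ)).re +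
        (completedRiemannZeta₀ (2 : ℝ)).re + (completedRiemannZeta₀ (0 : ℝ)).re := by
  obtain ⟨hconv, hderiv⟩ := hasDerivAt_completedRiemannZeta₀ σ
  rw [hderiv.deriv, norm_div, mellin]
  simp only [RCLike.norm_ofNat]
  rw [div_le_iff₀ (by norm_num : (0 : ℝ) < 4), re_completedRiemannZeta₀_ofReal,
    re_completedRiemannZeta₀_ofReal, re_completedRiemannZeta₀_ofReal, re_completedRiemannZeta₀_ofReal]
  have hI : ∀ σ' : ℝ, IntegrableOn (fun t : ℝ ↦ t ^ (σ' / 2 - 1) * kernel t) (Ioi 0) :=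
    integrableOn_kernel
  -- ‖∫‖ ≤ ∫ ‖‖ = ∫ t^{σ/2-1} |log t| k ≤ ∫ majorant
  have hnorm : ∫ t in Ioi (0 : ℝ), ‖(t : ℂ) ^ ((σ : ℂ) / 2 - 1) • (Real.log t • (kernel t : ℂ))‖ =
      ∫ t in Ioi (0 : ℝ), t ^ (σ / 2 - 1) * |Real.log t| * kernel t := by
    refine setIntegral_congr_fun measurableSet_Ioi (fun t ht ↦ ?_)
    have ht : (0 : ℝ) < t := ht
    rw [norm_smul, norm_smul, Complex.norm_cpow_eq_rpow_re_of_pos ht, Real.norm_eq_abs,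
      Complex.norm_real, Real.norm_of_nonneg (kernel_nonneg t)]
    simp
    ring
  have hint : IntegrableOn (fun t : ℝ ↦ t ^ (σ / 2 - 1) * |Real.log t| * kernel t) (Ioi 0) := by
    have := hconv.norm
    rw [MeasureTheory.IntegrableOn] at *
    refine (IntegrableOn.congr_fun this (fun t ht ↦ ?_) measurableSet_Ioi)
    have ht : (0 : ℝ) < t := ht
    rw [norm_smul, norm_smul, Complex.norm_cpow_eq_rpow_re_of_pos ht, Real.norm_eq_abs,
      Complex.norm_real, Real.norm_of_nonneg (kernel_nonneg t)]
    simp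
    ring
  calc ‖∫ t in Ioi (0 : ℝ), (t : ℂ) ^ ((σ : ℂ) / 2 - 1) • (Real.log t • (kernel t : ℂ))‖
      ≤ ∫ t in Ioi (0 : ℝ), ‖(t : ℂ) ^ ((σ : ℂ) / 2 - 1) • (Real.log t • (kernel t : ℂ))‖ :=
        norm_integral_le_integral_norm _
    _ = ∫ t in Ioi (0 : ℝ), t ^ (σ / 2 - 1) * |Real.log t| * kernel t := hnorm
    _ ≤ ∫ t in Ioi (0 : ℝ), 2 * (t ^ ((1 : ℝ) / 2 - 1) + t ^ ((-1 : ℝ) / 2 - 1)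
          + t ^ ((2 : ℝ) / 2 - 1) + t ^ ((0 : ℝ) / 2 - 1)) * kernel t := by
        refine setIntegral_mono_on hint ?_ measurableSet_Ioi (fun t ht ↦ pointwise_bound h0 h1 ht)
        have h4 : IntegrableOn (fun t : ℝ ↦ t ^ ((1 : ℝ) / 2 - 1) * kernel t
            + t ^ ((-1 : ℝ) / 2 - 1) * kernel t + t ^ ((2 : ℝ) / 2 - 1) * kernel t
            + t ^ ((0 : ℝ) / 2 - 1) * kernel t) (Ioi 0) :=
          (((hI 1).add (hI (-1))).add (hI 2)).add (hI 0)
        refine IntegrableOn.congr_fun (h4.const_mul 2) (fun t ht ↦ ?_) measurableSet_Ioi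
        ring
    _ = ((∫ t in Ioi (0 : ℝ), t ^ ((1 : ℝ) / 2 - 1) * kernel t) / 2 +
          (∫ t in Ioi (0 : ℝ), t ^ ((-1 : ℝ) / 2 - 1) * kernel t) / 2 +
          (∫ t in Ioi (0 : ℝ), t ^ ((2 : ℝ) / 2 - 1) * kernel t) / 2 +
          (∫ t in Ioi (0 : ℝ), t ^ ((0 : ℝ) / 2 - 1) * kernel t) / 2) * 4 := by
        have e : ∀ t : ℝ, 2 * (t ^ ((1 : ℝ) / 2 - 1) + t ^ ((-1 : ℝ) / 2 - 1)
            + t ^ ((2 : ℝ) / 2 - 1) + t ^ ((0 : ℝ) / 2 - 1)) * kernel t =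
            2 * ((t ^ ((1 : ℝ) / 2 - 1) * kernel t + t ^ ((-1 : ℝ) / 2 - 1) * kernel t)
              + t ^ ((2 : ℝ) / 2 - 1) * kernel t + t ^ ((0 : ℝ) / 2 - 1) * kernel t) := by
          intro t; ring
        simp_rw [e]
        have h3 : IntegrableOn (fun t : ℝ ↦ t ^ ((1 : ℝ) / 2 - 1) * kernel t
            + t ^ ((-1 : ℝ) / 2 - 1) * kernel t + t ^ ((2 : ℝ) / 2 - 1) * kernel t) (Ioi 0) :=
          ((hI 1).add (hI (-1))).add (hI 2)
        have h2 : IntegrableOn (fun t : ℝ ↦ t ^ ((1 : ℝ) / 2 - 1) * kernel t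
            + t ^ ((-1 : ℝ) / 2 - 1) * kernel t) (Ioi 0) := (hI 1).add (hI (-1))
        rw [integral_const_mul, integral_add h3 (hI 0), integral_add h2 (hI 2),
          integral_add (hI 1) (hI (-1))]
        ring

/-- `E(−1) = E(2)` (functional equation `completedRiemannZeta₀_one_sub`). [folklore] -/
theorem re_completedRiemannZeta₀_neg_one_eq :
    (completedRiemannZeta₀ (-1 : ℝ)).re = (completedRiemannZeta₀ (2 : ℝ)).re := by
  have := completedRiemannZeta₀_one_sub 2
  rw [show (1 : ℂ) - 2 = -1 by norm_num] at this
  rw [show ((-1 : ℝ) : ℂ) = -1 by push_cast; ring, Complex.ofReal_ofNat, this]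

/-- Numerical consequence: `‖E'(σ)‖ < 1` for `0 < σ < 1`. [folklore] -/
theorem norm_deriv_completedRiemannZeta₀_lt_one {σ : ℝ} (h0 : 0 < σ) (h1 : σ < 1) :
    ‖deriv completedRiemannZeta₀ σ‖ < 1 := by
  have h := norm_deriv_completedRiemannZeta₀_le h0 h1
  rw [re_completedRiemannZeta₀_neg_one_eq, re_completedRiemannZeta₀_zero_eq] at h
  have h2 := re_completedRiemannZeta₀_two_lt
  have h3 := re_completedRiemannZeta₀_one_lt
  linarith

end RealZeros

/-- **Discharge** of `riemannZeta_ne_zero_of_mem_Ioo`: `ζ(σ) ≠ 0` for real `0 < σ < 1`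
(indeed `Re Λ(σ) < 0`, `RealZeros.re_completedRiemannZeta_neg`, and `Γℝ(σ) ≠ 0`).
Titchmarsh proves it from `(1 − 2^{1−s})ζ(s) = η(s) > 0`; the proof here uses the theta kernel
instead. [cite: Titchmarsh1986, §2.12 (2.12.4)] -/
theorem riemannZeta_ne_zero_of_mem_Ioo_holds : riemannZeta_ne_zero_of_mem_Ioo := by
  intro σ h0 h1
  have hσ0 : (σ : ℂ) ≠ 0 := by exact_mod_cast h0.ne'
  rw [riemannZeta_def_of_ne_zero hσ0]
  refine div_ne_zero (fun h ↦ ?_) (Gammaℝ_ne_zero_of_re_pos (by simpa using h0))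
  have := RealZeros.re_completedRiemannZeta_neg h0 h1
  rw [h, Complex.zero_re] at this
  exact lt_irrefl 0 this

/-- **Discharge** of `deriv_riemannZeta_ne_zero_of_mem_Ioo`: `ζ'(σ) ≠ 0` for real
`0 < σ < 1/2`. If `ζ'(σ) = 0` then `Λ'(σ) = Λ(σ) · Γℝ'/Γℝ(σ)` with
`Γℝ'/Γℝ(σ) = −½ log π + ½ψ(σ/2 + 1) − 1/σ ≤ −1/σ − 1/4` real (`log π ≥ 1`, `ψ ≤ 1 − γ ≤ 1/2` on
`(0, 2]`), `Re Λ(σ) = Re E(σ) − 1/σ − 1/(1−σ)` with `Re E(σ) ≤ 2/3`, and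
`Re Λ'(σ) = Re E'(σ) + 1/σ² − 1/(1−σ)²` with `|E'(σ)| < 1`; these are incompatible. [folklore] -/
theorem deriv_riemannZeta_ne_zero_of_mem_Ioo_holds : deriv_riemannZeta_ne_zero_of_mem_Ioo := by
  intro σ h0 h1 hζ
  have hσ0 : (σ : ℂ) ≠ 0 := by exact_mod_cast h0.ne'
  have hσ1 : (σ : ℂ) ≠ 1 := by
    intro h
    have := congrArg Complex.re h
    simp at this
    linarith
  have hhalf : ∀ m : ℕ, (σ : ℂ) / 2 ≠ -m := by
    intro m h
    have := congrArg Complex.re h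
    simp at this
    have : (0 : ℝ) ≤ m := m.cast_nonneg
    linarith
  -- Step 1: `ζ = Λ / Γℝ` near `σ`; `ζ'(σ) = 0` forces `Λ'(σ) = Λ(σ) L`, `L = Γℝ'/Γℝ(σ)`.
  set L : ℂ := -(Complex.log π) / 2 + Complex.digamma ((σ : ℂ) / 2) / 2 with hL
  have hΛd : HasDerivAt completedRiemannZeta (deriv completedRiemannZeta σ) σ :=
    (differentiableAt_completedZeta hσ0 hσ1).hasDerivAt
  have hΓd : HasDerivAt Gammaℝ (Gammaℝ σ * L) σ := RealZeros.hasDerivAt_Gammaℝ hhalf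
  have hG0 : Gammaℝ (σ : ℂ) ≠ 0 := Gammaℝ_ne_zero_of_re_pos (by simpa using h0)
  have hquot := hΛd.div hΓd hG0
  have hev : riemannZeta =ᶠ[𝓝 (σ : ℂ)] (fun s ↦ completedRiemannZeta s / Gammaℝ s) := by
    filter_upwards [eventually_ne_nhds hσ0] with s hs
    exact riemannZeta_def_of_ne_zero hs
  have hζd := hquot.congr_of_eventuallyEq hev
  have hzero : (deriv completedRiemannZeta σ * Gammaℝ σ -
      completedRiemannZeta σ * (Gammaℝ σ * L)) / Gammaℝ σ ^ 2 = 0 := by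
    rw [← hζd.deriv]
    exact hζ
  have key : deriv completedRiemannZeta σ = completedRiemannZeta σ * L := by
    rw [div_eq_zero_iff, sub_eq_zero] at hzero
    rcases hzero with h | h
    · apply mul_right_cancel₀ hG0
      rw [h]
      ring
    · exact (pow_ne_zero 2 hG0 h).elim
  -- Step 2: `Λ' = E' + 1/σ² − 1/(1−σ)²`.
  obtain ⟨-, hE⟩ := RealZeros.hasDerivAt_completedRiemannZeta₀ σ
  set E' : ℂ := mellin (fun t ↦ Real.log t • (RealZeros.kernel t : ℂ)) ((σ : ℂ) / 2) / 4 with hE'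
  have hΛfun : completedRiemannZeta =
      fun s ↦ completedRiemannZeta₀ s - 1 / s - 1 / (1 - s) := funext completedRiemannZeta_eq
  have hσ1' : (1 : ℂ) - σ ≠ 0 := sub_ne_zero.2 (Ne.symm hσ1)
  have hinv1 : HasDerivAt (fun s : ℂ ↦ 1 / s) (-((σ : ℂ) ^ 2)⁻¹) σ := by
    simpa only [one_div] using hasDerivAt_inv hσ0
  have hinv2 : HasDerivAt (fun s : ℂ ↦ 1 / (1 - s)) (-((1 - (σ : ℂ)) ^ 2)⁻¹ * (0 - 1)) σ := by
    have h1 : HasDerivAt (fun s : ℂ ↦ 1 - s) (0 - 1) σ :=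
      (hasDerivAt_const (σ : ℂ) (1 : ℂ)).sub (hasDerivAt_id' (σ : ℂ))
    have h2 := (hasDerivAt_inv hσ1').comp (σ : ℂ) h1
    simpa only [one_div, Function.comp_def] using h2
  have hΛd2 : HasDerivAt completedRiemannZeta
      (E' - (-((σ : ℂ) ^ 2)⁻¹) - (-((1 - (σ : ℂ)) ^ 2)⁻¹ * (0 - 1))) σ := by
    rw [hΛfun]
    exact (hE.sub hinv1).sub hinv2
  have hΛ' : deriv completedRiemannZeta σ = E' + 1 / (σ : ℂ) ^ 2 - 1 / (1 - (σ : ℂ)) ^ 2 := by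
    rw [hΛd2.deriv]
    ring
  -- Step 3: `L` is real and `Re L ≤ −1/σ − 1/4`.
  have hψ : Complex.digamma ((σ : ℂ) / 2) = Complex.digamma ((σ : ℂ) / 2 + 1) - 2 / σ := by
    rw [Complex.digamma_apply_add_one _ hhalf]
    field_simp
    ring
  have hcast : (σ : ℂ) / 2 + 1 = ((σ / 2 + 1 : ℝ) : ℂ) := by push_cast; ring
  have hψre : (Complex.digamma ((σ : ℂ) / 2 + 1)).re ≤ 1 - Real.eulerMascheroniConstant := by
    rw [hcast]
    exact RealZeros.re_digamma_ofReal_le (by linarith) (by linarith)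
  have hψim : (Complex.digamma ((σ : ℂ) / 2 + 1)).im = 0 := by
    rw [hcast, RealZeros.digamma_ofReal (by linarith)]
    exact Complex.ofReal_im _
  have hlogre : (Complex.log π).re = Real.log π := Complex.log_ofReal_re π
  have hlogim : (Complex.log π).im = 0 := by
    rw [← Complex.ofReal_log Real.pi_pos.le]
    exact Complex.ofReal_im _
  have hlogπ : 1 ≤ Real.log π := by
    rw [Real.le_log_iff_exp_le Real.pi_pos]
    have := Real.exp_one_lt_d9
    linarith [Real.pi_gt_three]
  have hγ := Real.one_half_lt_eulerMascheroniConstant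
  have hLim : L.im = 0 := by
    simp [hL, hψ, hlogim, hψim]
  have hLre : L.re ≤ -(1 / σ) - 1 / 4 := by
    have : L.re = -(Real.log π) / 2 +
        ((Complex.digamma ((σ : ℂ) / 2 + 1)).re - 2 / σ) / 2 := by
      simp [hL, hψ, hlogre]
    rw [this]
    have h2σ : 1 / σ = (2 / σ) / 2 := by ring
    rw [h2σ]
    linarith
  -- Step 4: real parts of `key`.
  have hEre : (completedRiemannZeta₀ σ).re ≤ 2 / 3 := by
    have := RealZeros.re_completedRiemannZeta₀_le h0 (by linarith)
    rw [RealZeros.re_completedRiemannZeta₀_zero_eq] at this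
    linarith [RealZeros.re_completedRiemannZeta₀_one_lt]
  have hE're : E'.re ≤ 1 := by
    have h := RealZeros.norm_deriv_completedRiemannZeta₀_lt_one h0 (by linarith)
    rw [hE.deriv] at h
    exact ((Complex.re_le_norm _).trans h.le)
  have hΛre : (completedRiemannZeta σ).re = (completedRiemannZeta₀ σ).re - 1 / σ - 1 / (1 - σ) := by
    rw [completedRiemannZeta_eq]
    have e1 : (1 / (σ : ℂ)).re = 1 / σ := by
      rw [← Complex.ofReal_one, ← Complex.ofReal_div, Complex.ofReal_re]
    have e2 : (1 / (1 - (σ : ℂ))).re = 1 / (1 - σ) := by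
      rw [← Complex.ofReal_one, ← Complex.ofReal_sub, ← Complex.ofReal_div, Complex.ofReal_re]
    simp only [Complex.sub_re, e1, e2]
  have hΛ're : (deriv completedRiemannZeta σ).re = E'.re + 1 / σ ^ 2 - 1 / (1 - σ) ^ 2 := by
    rw [hΛ']
    have e1 : (1 / (σ : ℂ) ^ 2).re = 1 / σ ^ 2 := by
      rw [← Complex.ofReal_one, ← Complex.ofReal_pow, ← Complex.ofReal_div, Complex.ofReal_re]
    have e2 : (1 / (1 - (σ : ℂ)) ^ 2).re = 1 / (1 - σ) ^ 2 := by
      rw [← Complex.ofReal_one, ← Complex.ofReal_sub, ← Complex.ofReal_pow, ← Complex.ofReal_div,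
        Complex.ofReal_re]
    simp only [Complex.add_re, Complex.sub_re, e1, e2]
  have keyre : (deriv completedRiemannZeta σ).re = (completedRiemannZeta σ).re * L.re := by
    rw [key, Complex.mul_re, hLim, mul_zero, sub_zero]
  rw [hΛ're, hΛre] at keyre
  -- Step 5: elementary contradiction.
  set a : ℝ := 1 / σ with ha
  set b : ℝ := 1 / (1 - σ) with hb
  set e : ℝ := (completedRiemannZeta₀ σ).re with he
  set e' : ℝ := E'.re with he'
  set ℓ : ℝ := L.re with hℓ
  have ha2 : 2 < a := by
    rw [ha, lt_div_iff₀ h0]; linarith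
  have hb1 : 1 < b := by
    rw [hb, lt_div_iff₀ (by linarith)]; linarith
  have hb2 : b < 2 := by
    rw [hb, div_lt_iff₀ (by linarith)]; linarith
  have ha' : 1 / σ ^ 2 = a ^ 2 := by rw [ha]; field_simp
  have hb' : 1 / (1 - σ) ^ 2 = b ^ 2 := by rw [hb]; field_simp
  rw [ha', hb'] at keyre
  have hneg : e - a - b ≤ 0 := by linarith
  have hprod : (e - a - b) * (-a - 1 / 4) ≤ (e - a - b) * ℓ :=
    mul_le_mul_of_nonpos_left (by linarith) hneg
  have hpos : 0 ≤ (a - 2) * (b - e + 1 / 4) := mul_nonneg (by linarith) (by linarith)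
  nlinarith [hprod, hpos, hb1, hb2, hEre, hE're, keyre]

/-- **Speiser's theorem from Levinson–Montgomery's Theorem 1 alone** (plus the open-strip
description of the non-trivial zeros): `speiser_iff_of_levinsonMontgomery` with the two
real-axis leaves discharged. [cite: LevinsonMontgomery1974, Cor. to Thm. 1] -/
theorem speiser_iff_of_levinsonMontgomery_thm1 (h₁ : levinsonMontgomery_thm1_isBigO)
    (h₂ : levinsonMontgomery_thm1_seq) (h₃ : Literature.NumberTheory.LFunctions.mem_riemannZetaNontrivialZeros_iff) :
    speiser_iff :=
  speiser_iff_of_levinsonMontgomery h₁ h₂ h₃ riemannZeta_ne_zero_of_mem_Ioo_holds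
    deriv_riemannZeta_ne_zero_of_mem_Ioo_holds

end Literature.NumberTheory.LFunctions

end
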